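import Summits.BirchSwinnertonDyer.BirchSwinnertonDyer.Theorems.GenusKolyvaginAtTwoPowDvdShaCardAtTwoRTEigenIndexTwo
import Summits.BirchSwinnertonDyer.BirchSwinnertonDyer.Theorems.GenusKolyvaginAtTwoEquivariantChebotarevAtTwoQ5Shape
import Summits.BirchSwinnertonDyer.BirchSwinnertonDyer.Theorems.GenusKolyvaginAtTwoEquivariantKolyvaginExactAtTwoPairBookkeeping
import Summits.BirchSwinnertonDyer.BirchSwinnertonDyer.Theorems.GenusKolyvaginAtTwoPowDvdShaCardAtTwoRTGrossLevelAtTwo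
import Literature.NumberTheory.EllipticCurves.HeegnerPointsKolyvaginCebotarevPairProofs
import Literature.NumberTheory.EllipticCurves.HeegnerPointsKolyvaginProp82Proofs
import Literature.NumberTheory.EllipticCurves.LocalH1TateDualityLangTateProofs
import Summits.BirchSwinnertonDyer.BirchSwinnertonDyer.Theorems.PrintCFramBottomClassIndexLawFiveLeBorelKolyvaginPrimeFrobenius
import HarnessLib

/-!
# Route `GenusKolyvaginAtTwo`, crux L_T `PowDvdShaCardAtTwoRT` (stmt-BirchSwinnertonDyer-23242), LINE 18 `plus_descent`
# v5.2, stub KS — the weak swap loop's index hypothesis `hK` IN ARITHMETIC CURRENCY: at a DEEP Kolyvagin prime the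
# strict local condition has index `∣ 2` on the `2`-torsion of a `τ`-EIGEN subgroup of Selmer classes

Seat `bsd-line-gk2-p5` g23 (WIDTH-5 attach, cell `bsd-f1-sign2`), `--supports stmt-BirchSwinnertonDyer-23242` (helper; it
closes nothing, and BSD is not proved by it).

WHY.  gk2-p2's weak prime-swapping loop (`exists_avoiding_of_weakSwapOracle`, `…RTPrimeSwappingWeak`; two-prime form
`exists_avoiding_of_twoPrimeReciprocity_weak`, `…RTTwoPrimeSwapWeak`; level-exporting form gk2-p4
`exists_inv_avoiding_of_twoPrimeReciprocity_weak`, `…RTPrimeSwappingWeakExport`) — the engine of the DROPS of stub KS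
`stub_kolyvaginSystemAtTwo` — displays the index hypothesis
`hK : ∀ l, good l → ∀ s ⊆ R, (A l).relIndex (closure s ⊓ V[p]) ∣ p`.  LEAD gk2-p1 g15 proved its ALGEBRA
(`relIndex_ker_inf_torsionBy_two_dvd_two`, `…RTEigenIndexTwo`): on a `τ`-EIGEN subgroup `C` of `V` the kernel of a
`τ`-equivariant `loc : V → A ≅ ℤ/2^L[C₂]` has index `∣ 2` on `C[2]` (the `2`-torsion `τ`-fixed vectors of a free rank-one
`ℤ/2^L[C₂]`-module lie on the norm line).  gk2-p4 g19 (HOME/HANDOFF «gk2-p4 g19», bus 2026-08-29T11:02Z) listed the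
ARITHMETIC instantiation as open for the KS integrator.  THIS FILE supplies it, in the currency of the drops
(`A ℓ = ⨅_{v ∋ ℓ} ker (H¹(K,E[2^L]) → H¹(K_v,E[2^L]))`, `R ⊆` ε-eigen Selmer classes, `good ℓ` = a prime with
`Frob(ℓ) = Frob(∞)` on `K(E[2^L])`):

* §1 `exists_frobenius_conjGalCMH_mul_of_frobEqFrobInfty_at` — for ANY prime `ℓ ∤ d_K` with `FrobEqFrobInfty W K n ℓ`
  (Gross (3.2) at level `n`) the place `w ∋ ℓ` of the imaginary quadratic `K` is unique and carries an arithmetic Frobenius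
  of the shape `g^τ̃ g` (`g ∈ Γ_{K(E[n])}`, `τ̃ = e c₀ e⁻¹` the involutive lift of complex conjugation along the witness's
  `c₀`) — Steps F–G of the tree's McCallum Cor. 3.2 (`exists_kolyvaginPrime_gt_of_galoisElement`) run on the WITNESS of
  (3.2) instead of on a Čebotarev element (the `δ`-free, `primesAbove`-form of `…PrintCFram….BorelKolyvaginPairing.
  exists_frobenius_conjGalCMH_mul_of_frobEqFrobInfty`, whose lemmas `isUnramifiedIn_of_not_dvd_discr` and
  `exists_eq_mul_absGaloisRestrict_of_smul_eq` are reused).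
* §2 `h1Eval_conjAct_conjGalCMH_mul` — `[τ_* c, g^τ̃ g] = τ̃ [c, g^τ̃ g]`: evaluation at that Frobenius is `τ`-EQUIVARIANT
  (`IsLiftOfAut.h1Eval_conjAct`, `conjGalCMH` an involutive homomorphism, `[c, ·]` additive on `Γ_{K(E[n])}`).
* §3 **`relIndex_iInf_torsionLocalKer_inf_torsionBy_two_dvd_two`** — `W/ℚ` elliptic with `Δ < 0`, `K` imaginary quadratic,
  `τ ≠ 1`, `L ≥ 1`, `ℓ ∤ 2 N d_K` prime with `FrobEqFrobInfty W K (2^L) ℓ`, `ε = ±1`, `C ≤ H¹(K, E[2^L])` consisting of SELMER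
  classes with `τ_* c = ε c`: **`(⨅_{v ∋ ℓ} torsionLocalKer_v).relIndex (C ⊓ H¹[2]) ∣ 2`**.  Proof: Selmer ⟹ unramified at
  the good place `w ∤ 2^L` (`selmerLocalKer_le_unramifiedKer`); the local criterion `c_w = 0 ⟺ [c, g^τ̃ g] = 0`
  (`torsionLocalKer_iff_h1Eval_of_isArithFrobAt`, Gross Prop. 9.6 / McCallum (3)); so on `C` the strict condition is the
  kernel of `loc = [·, g^τ̃ g] : H¹(K,E[2^L]) → E[2^L]`, which is `τ`-equivariant (§2) for the involution `τ̃` of `E[2^L]`,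
  and `E[2^L]` is free of rank one over `ℤ/2^L[τ̃]` (Q1's mechanism on `Δ < 0`: a `2^{L−1}`-th root of a `2`-torsion point
  moved by `c₀`, `pow_dvd_of_zsmul_add_zsmul_smul_eq_zero`; spanning by counting, `GrossLevelAtTwo.exists_coordEquiv_of_indep`);
  LEAD's `relIndex_ker_inf_torsionBy_two_dvd_two` concludes.  Zhang–Kolyvagin packaging:
  `relIndex_iInf_torsionLocalKer_closure_dvd_two_of_isKolyvaginPrime` (the loop's `∀ s ⊆ R` binder verbatim).
* §4 plug forms: `…_of_isKolyvaginPrime_natCast` (the loop's literal `p := 2` binder, `torsionBy V ((2:ℕ):ℤ)`, `∣ (2:ℕ)`),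
  `forall_mem_closure_selmer_and_conjAct_eq` (Selmer `ε`-eigenclasses form a subgroup) and
  `relIndex_iInf_torsionLocalKer_closure_sup_zmultiples_dvd_two` (the KS clause's subgroup `⟨u⟩ ⊔ ⟨c_L(1)⟩`).

HONEST FRAMING.  THEOREMS ONLY (no definition, no named fact, no `sorry`); nothing here touches the skeleton or the stubs
NPh/KS/Deep/P; the crux, stub KS and BSD are NOT proved by any of this.

References: [McCallumLMS1991] §3 (3), Prop. 3.1 (proof), §5 proof of Prop. 5.2 (the characters `φ_{Frob(λ_L)}` on `C[p]`);
[GrossLMS1991] §3 (3.1)–(3.3), §9 Prop. 9.6; [SilvermanAEC2009] Cor. X.4.4.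
-/

set_option autoImplicit false
-- `Summit.<P>.<Sub>` repeats `BirchSwinnertonDyer` by the tree's layout convention (D-0017)
set_option linter.dupNamespace false

noncomputable section

open scoped Classical

namespace Summit.BirchSwinnertonDyer.BirchSwinnertonDyer.Theorems.GenusExact.PlusDescent

open WeierstrassCurve NumberField IsDedekindDomain Field
open Literature.NumberTheory.GaloisRepresentations Literature.NumberTheory.EllipticCurves
open Summit.BirchSwinnertonDyer.BirchSwinnertonDyer.Theorems.KolyvaginEigenTwo (exists_twoTorsion_smul_ne_of_Δ_neg)
open Summit.BirchSwinnertonDyer.BirchSwinnertonDyer.Theorems.PrintCFram.BorelKolyvaginPairing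
  (isUnramifiedIn_of_not_dvd_discr exists_eq_mul_absGaloisRestrict_of_smul_eq)

variable (W : WeierstrassCurve ℚ) [W.IsElliptic] {K : Type} [Field K] [NumberField K]

/-! ## §1 The Frobenius at the place of a GIVEN prime with `Frob(ℓ) = Frob(∞)` on `K(E[n])` is `g^τ̃ g` -/

omit [W.IsElliptic] in
/-- **The Frobenius at the place of a GIVEN Kolyvagin prime is `g^τ̃ g`** (Gross (3.2) read at `λ`).  `K` imaginary quadratic
with non-trivial automorphism `c`, `ℓ` a prime with `ℓ ∤ d_K` and `Frob(ℓ) = Frob(∞)` in `Gal(K(E_n)/ℚ)` (`FrobEqFrobInfty W K n ℓ`).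
Then, for the complex conjugation `c₀` of the witness and the lift `τ̃ = e c₀ e⁻¹` of `c`: there are the place `v ∋ ℓ` of `ℚ`,
the UNIQUE place `w ∋ ℓ` of `K` (above `v`), a prime `𝔔 ∣ w` of `\bar ℤ_K` and `g ∈ Γ_{K(E[n])}` such that **`g^τ̃ g` is an
arithmetic Frobenius at `𝔔`** — the Frobenius datum of the tree's local criterion `torsionLocalKer_iff_h1Eval_of_isArithFrobAt`.
Steps F–G of the tree's `exists_kolyvaginPrime_gt_of_galoisElement`, run on the witness `h = c₀ · res g` of (3.2)
(`exists_place_inert_of_not_mem_range`, `sq_eq_absGaloisRestrict_conjGal_mul`). [cite: GrossLMS1991, §3 (3.2) and Prop. 9.6]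
[cite: McCallumLMS1991, §3 (3)] -/
theorem exists_frobenius_conjGalCMH_mul_of_frobEqFrobInfty_at (hK : IsImaginaryQuadratic K)
    {c : K ≃ₐ[ℚ] K} (hc : c ≠ 1) {n ℓ : ℕ} (hℓ : ℓ.Prime)
    (hℓD : ¬ ((ℓ : ℤ) ∣ NumberField.discr K)) (hfrob : FrobEqFrobInfty W K n ℓ) :
    ∃ (c₀ : absoluteGaloisGroup ℚ) (_ : IsComplexConjugation (Rat.castHom ℝ) c₀)
      (ht : IsLiftOfAut c (absGaloisTransport (K := ℚ) (L := K) c₀).toRingEquiv)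
      (v : HeightOneSpectrum (𝓞 ℚ)) (w : HeightOneSpectrum (𝓞 K)) (𝔔 : Ideal (absIntegers (𝓞 K) K))
      (g : absoluteGaloisGroup K),
      (ℓ : 𝓞 ℚ) ∈ v.asIdeal ∧ w.under (𝓞 ℚ) = v ∧ (ℓ : 𝓞 K) ∈ w.asIdeal ∧
        (∀ w' : HeightOneSpectrum (𝓞 K), (ℓ : 𝓞 K) ∈ w'.asIdeal → w' = w) ∧
        𝔔 ∈ w.primesAbove ∧ IsArithFrobAt (𝓞 K) (ht.conjGalCMH g * g) 𝔔 ∧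
        g ∈ torsionFixing (W.baseChange K) (n : ℤ) := by
  -- (adapted from `PrintCFram.BorelKolyvaginPairing.exists_frobenius_conjGalCMH_mul_of_frobEqFrobInfty` and the tree's
  -- `exists_kolyvaginPrime_gt_of_galoisElement`, Steps F–G)
  haveI : Algebra.IsQuadraticExtension ℚ K := ⟨hK.1⟩
  haveI : IsTotallyComplex K := hK.2
  obtain ⟨v, 𝔓₀, h, c₀, hℓv, h𝔓₀, hh, hc₀, hP, hKx⟩ := hfrob
  have ht : IsLiftOfAut c (absGaloisTransport (K := ℚ) (L := K) c₀).toRingEquiv :=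
    RatClosure.isLiftOfAut_absGaloisTransport_of_isImaginaryQuadratic hK hc hc₀
  -- `h = c₀ · res g`, `g ∈ Γ_{K(E[n])}`
  obtain ⟨g, hgT, hhg⟩ := exists_eq_mul_absGaloisRestrict_of_smul_eq W (K := K) hP hKx
  -- Step F of the tree: `ℓ` is inert with Frobenius `τ' = g^τ g` over `K`
  have hunr : Algebra.IsUnramifiedIn (𝓞 K) v.asIdeal :=
    isUnramifiedIn_of_not_dvd_discr hℓ hℓD hℓv
  have hHi := index_range_absGaloisRestrict_eq_finrank ℚ K
  haveI hHn : ((absGaloisRestrict ℚ K).range).Normal :=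
    Subgroup.normal_of_index_eq_two (hHi.trans hK.1)
  have hI := inertia_le_range_absGaloisRestrict_of_isUnramifiedIn (K := K) hunr h𝔓₀
  have hΦH : h ∉ (absGaloisRestrict ℚ K).range := by
    intro hmem
    apply hc₀.not_mem_range_absGaloisRestrict (L := K) IsTotallyComplex.isComplex
    change c₀ ∈ ((absGaloisRestrict ℚ K).range : Set (absoluteGaloisGroup ℚ))
    have h' : c₀ = h * (absGaloisRestrict ℚ K g)⁻¹ := by rw [hhg]; group
    rw [SetLike.mem_coe, h']
    exact Subgroup.mul_mem _ hmem (Subgroup.inv_mem _ ⟨g, rfl⟩)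
  obtain ⟨w, 𝔔, τ', hwv, hwuniq, -, h𝔔w, -, hτ', hresτ'⟩ :=
    exists_place_inert_of_not_mem_range (F := ℚ) (M := K) (hK.1 ▸ Nat.prime_two) hHn
      (hHi.trans rfl) hunr h𝔓₀ hI hh hΦH
  rw [hK.1, hhg, sq_eq_absGaloisRestrict_conjGal_mul hc₀ ht g] at hresτ'
  have hτ'eq : τ' = ht.conjGalCMH g * g := absGaloisRestrict_injective ℚ K hresτ'
  -- `ℓ ∈ w`, and `w` is the only place of `K` containing `ℓ`
  have hℓw : (ℓ : 𝓞 K) ∈ w.asIdeal := by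
    have h1 : (ℓ : 𝓞 ℚ) ∈ (w.under (𝓞 ℚ)).asIdeal := by rw [hwv]; exact hℓv
    rw [HeightOneSpectrum.under_asIdeal, Ideal.under_def, Ideal.mem_comap, map_natCast] at h1
    exact h1
  have hwuniq' : ∀ w' : HeightOneSpectrum (𝓞 K), (ℓ : 𝓞 K) ∈ w'.asIdeal → w' = w := by
    intro w' hw'
    apply hwuniq
    apply HeightOneSpectrum.eq_of_natCast_mem_rat hℓ _ hℓv
    rw [HeightOneSpectrum.under_asIdeal, Ideal.under_def, Ideal.mem_comap, map_natCast]
    exact hw'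
  exact ⟨c₀, hc₀, ht, v, w, 𝔔, g, hℓv, hwv, hℓw, hwuniq', h𝔔w, hτ'eq ▸ hτ', hgT⟩

/-! ## §2 Evaluation at `g^τ̃ g` is `τ`-equivariant; spanning by counting -/

omit [W.IsElliptic] in
/-- **`[σ_* c, g^τ̃ g] = τ̃ [c, g^τ̃ g]`.** For an involutive lift `τ̃` of `σ ∈ Aut(K/ℚ)` and `g ∈ Γ_{K(E[n])}`:
`[σ_* c, ρ] = τ̃ [c, ρ^τ̃]` (`IsLiftOfAut.h1Eval_conjAct`) with `(g^τ̃ g)^τ̃ = g g^τ̃` (`conjGalCMH` is a homomorphism and an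
involution) and `[c, g g^τ̃] = [c, g] + [c, g^τ̃] = [c, g^τ̃ g]` (`[c, ·]` is additive on `Γ_{K(E[n])}`).  So evaluation at the
Frobenius `g^τ̃ g` of §1 intertwines `σ_*` on `H¹(K, E[n])` with `τ̃` on `E[n]`. [cite: McCallumLMS1991, §3 proof of Prop. 3.1] -/
theorem h1Eval_conjAct_conjGalCMH_mul {σ : K ≃ₐ[ℚ] K} {τ : AlgebraicClosure K ≃+* AlgebraicClosure K}
    (hτ : IsLiftOfAut σ τ) (hinv : ∀ x, τ (τ x) = x) (n : ℤ) {g : absoluteGaloisGroup K}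
    (hg : g ∈ torsionFixing (W.baseChange K) n) (c : galH1Torsion (W.baseChange K) n) :
    h1Eval (W.baseChange K) n (conjAct W σ n c) (hτ.conjGalCMH g * g) =
      hτ.torsionMap W n (h1Eval (W.baseChange K) n c (hτ.conjGalCMH g * g)) := by
  have hgτ : hτ.conjGalCMH g ∈ torsionFixing (W.baseChange K) n := hτ.conjGalCMH_mem_torsionFixing W hinv n hg
  have hF : hτ.conjGalCMH g * g ∈ torsionFixing (W.baseChange K) n := mul_mem hgτ hg
  rw [hτ.h1Eval_conjAct W n c hF, map_mul, hτ.conjGalCMH_conjGalCMH hinv,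
    h1Eval_mul (W.baseChange K) n c hg, h1Eval_mul (W.baseChange K) n c hgτ, add_comm]

/-- **Spanning by counting.** In an abelian group `A` of order `4^L` (`L ≥ 1`) killed by `2^L`, a `ℤ/2^L`-independent pair
`P₁, P₂` spans: `(a, b) ↦ a P₁ + b P₂` is an injective map `(ℤ/2^L)² → A` between sets of the same size
(`GrossLevelAtTwo.exists_coordEquiv_of_indep`). [folklore] -/
theorem exists_eq_zsmul_add_zsmul_of_indep {A : Type*} [AddCommGroup A] {L : ℕ} (hL : 1 ≤ L)
    (hA : ∀ t : A, ((2 ^ L : ℕ) : ℤ) • t = 0) (hcard : Nat.card A = (2 ^ L) ^ 2) {P₁ P₂ : A}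
    (hfree : ∀ a b : ℤ, a • P₁ + b • P₂ = 0 → (2 ^ L : ℤ) ∣ a ∧ (2 ^ L : ℤ) ∣ b) (Q : A) :
    ∃ a b : ℤ, Q = a • P₁ + b • P₂ := by
  obtain ⟨m, rfl⟩ : ∃ m, L = m + 1 := ⟨L - 1, by omega⟩
  haveI : NeZero (2 ^ (m + 1)) := ⟨pow_ne_zero _ two_ne_zero⟩
  have hA' : ∀ t : A, ((2 : ℤ) ^ (m + 1)) • t = 0 := fun t ↦ by exact_mod_cast hA t
  obtain ⟨e, he⟩ := GrossLevelAtTwo.exists_coordEquiv_of_indep m hA' hcard hfree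
  obtain ⟨⟨x, y⟩, rfl⟩ := e.surjective Q
  refine ⟨x.cast, y.cast, ?_⟩
  have h := he x.cast y.cast
  rw [ZMod.intCast_zmod_cast, ZMod.intCast_zmod_cast] at h
  exact h

/-! ## §3 The index of the strict condition at a deep Kolyvagin prime on the `2`-torsion of eigen Selmer classes -/

/-- **`hK` IN ARITHMETIC CURRENCY: at a deep Kolyvagin prime the strict local condition has index `∣ 2` on `C[2]` for a
`τ`-EIGEN subgroup `C` of Selmer classes.**  `W/ℚ` elliptic with `Δ(W) < 0`; `K` imaginary quadratic with non-trivial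
automorphism `τ`; `L ≥ 1`; `ℓ` a prime with `ℓ ≠ 2`, `ℓ ∤ d_K`, good reduction, and `Frob(ℓ) = Frob(∞)` on `K(E[2^L])`
(`FrobEqFrobInfty W K (2^L) ℓ`: the DEEP primes of LINE 18, e.g. the drops' Čebotarev primes); `ε = ±1`; `C ≤ H¹(K, E[2^L])` a
subgroup all of whose elements are SELMER and satisfy `τ_* c = ε • c` (e.g. `⟨u⟩ ⊔ ⟨c_L(1)⟩` for the `ε`-eigen Selmer classes `u`
of stub KS's avoidance clause).  Then the strict local condition at the place(s) of `K` over `ℓ`,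
`A ℓ = ⨅_{v ∋ ℓ} ker (H¹(K, E[2^L]) → H¹(K_v, E[2^L]))`, satisfies **`(A ℓ).relIndex (C ⊓ H¹(K,E[2^L])[2]) ∣ 2`** — the binder
`hK` of `exists_avoiding_of_weakSwapOracle` / `exists_(inv_)avoiding_of_twoPrimeReciprocity_weak` for `R ⊆` {ε-eigen Selmer
classes}, `good` = deep.  Proof: §1 gives the Frobenius `F = g^τ̃ g` at `𝔔 ∣ w ∋ ℓ`; Selmer classes are unramified at the good
place `w ∤ 2^L` (`selmerLocalKer_le_unramifiedKer`), so on `C` the strict condition is `[c, F] = 0`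
(`torsionLocalKer_iff_h1Eval_of_isArithFrobAt`, Gross Prop. 9.6 / McCallum (3)); `[·, F]` is `τ`-equivariant (§2) for the
involution `τ̃` of `E(K̄)[2^L]`, which is free of rank one over `ℤ/2^L[τ̃]` (a `2^{L−1}`-th root of a `2`-torsion point moved
by `c₀`, `Δ < 0`: Q1's mechanism, `pow_dvd_of_zsmul_add_zsmul_smul_eq_zero`; spanning by counting); LEAD's
`relIndex_ker_inf_torsionBy_two_dvd_two` concludes. [cite: McCallumLMS1991, §3 (3) and §5 proof of Prop. 5.2]
[cite: GrossLMS1991, §3 (3.2)–(3.3), Prop. 9.6] -/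
theorem relIndex_iInf_torsionLocalKer_inf_torsionBy_two_dvd_two (hΔ : W.Δ < 0) (hK : IsImaginaryQuadratic K)
    {τ : K ≃ₐ[ℚ] K} (hτ : τ ≠ 1) {L : ℕ} (hL : 1 ≤ L) {ℓ : ℕ} [hℓF : Fact ℓ.Prime] (hℓ2 : ℓ ≠ 2)
    (hℓD : ¬ ((ℓ : ℤ) ∣ NumberField.discr K)) (hgood : W.HasGoodReductionAtPrime ℓ)
    (hfrob : FrobEqFrobInfty W K (2 ^ L) ℓ) {ε : ℤ} (hε : ε = 1 ∨ ε = -1)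
    (C : AddSubgroup (galH1Torsion (W.baseChange K) ((2 ^ L : ℕ) : ℤ)))
    (hC : ∀ c ∈ C, c ∈ selmerGroup (W.baseChange K) ((2 ^ L : ℕ) : ℤ) ∧
      conjAct W τ ((2 ^ L : ℕ) : ℤ) c = ε • c) :
    (⨅ (v : HeightOneSpectrum (𝓞 K)) (_ : (ℓ : 𝓞 K) ∈ v.asIdeal),
        (W.baseChange K).torsionLocalKer (v.adicCompletion K) ((2 ^ L : ℕ) : ℤ)).relIndex
      (C ⊓ AddSubgroup.torsionBy (galH1Torsion (W.baseChange K) ((2 ^ L : ℕ) : ℤ)) (2 : ℤ)) ∣ 2 := by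
  have hℓ : ℓ.Prime := hℓF.out
  haveI : (W.baseChange K).IsElliptic := by rw [baseChange]; infer_instance
  have hp : Nat.Prime 2 := Nat.prime_two
  have hn : (2 ^ L : ℕ) ≠ 0 := pow_ne_zero L two_ne_zero
  -- ### §1: the Frobenius `F = g^τ̃ g` at `𝔔 ∣ w ∋ ℓ`
  obtain ⟨c₀, hc₀, ht, v, w, 𝔔, g, hℓv, hwv, hℓw, hwuniq, h𝔔w, hF, hgT⟩ :=
    exists_frobenius_conjGalCMH_mul_of_frobEqFrobInfty_at W hK hτ hℓ hℓD hfrob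
  have hinv : ∀ x, (absGaloisTransport (K := ℚ) (L := K) c₀).toRingEquiv
      ((absGaloisTransport (K := ℚ) (L := K) c₀).toRingEquiv x) = x := fun x ↦
    RatClosure.absGaloisTransport_absGaloisTransport_of_sq_eq_one hc₀.sq_eq_one x
  have hFT : ht.conjGalCMH g * g ∈ torsionFixing (W.baseChange K) ((2 ^ L : ℕ) : ℤ) :=
    mul_mem (ht.conjGalCMH_mem_torsionFixing W hinv _ hgT) hgT
  -- ### good reduction of `E_K` at `w`, and `w ∤ 2^L`
  haveI : w.asIdeal.LiesOver v.asIdeal := ⟨by rw [← hwv]; rfl⟩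
  have hgoodv : W.HasGoodReductionAt v := VisiblePairAtTwo.hasGoodReductionAt_of_hasGoodReductionAtPrime W hgood hℓv
  have hgoodw : (W.baseChange K).HasGoodReductionAt w :=
    hasGoodReductionAt_baseChange_of_hasGoodReductionAt W K v w hgoodv
  have hwbad : w ∉ (W.baseChange K).badPlaces (𝓞 K) := fun h ↦ h hgoodw
  have h2w : ((2 : ℕ) : 𝓞 K) ∉ w.asIdeal := not_natCast_mem_of_prime_ne hℓ hp hℓ2 w hℓw
  have hnw : ((((2 ^ L : ℕ) : ℤ)) : 𝓞 K) ∉ w.asIdeal := fun h ↦ by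
    apply h2w
    rw [Int.cast_natCast, Nat.cast_pow] at h
    exact w.isPrime.mem_of_pow_mem L h
  -- ### Selmer classes are unramified at the primes above `w`; the local criterion on `C`
  have hunr : ∀ c : C, ∀ 𝔓 ∈ w.primesAbove,
      (c : galH1Torsion (W.baseChange K) ((2 ^ L : ℕ) : ℤ)) ∈
        unramifiedKer (geomTorsion (W.baseChange K) ((2 ^ L : ℕ) : ℤ)) 𝔓 := by
    intro c 𝔓 h𝔓
    exact selmerLocalKer_le_unramifiedKer (HeightOneSpectrum.exists_mem_inertia_apply_eq_holds w)
      (W.baseChange K).smul_localPoints_eq_of_mem_inertia_holds hwbad hnw h𝔓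
      (((mem_selmerGroup_iff (W.baseChange K) _ (c : galH1Torsion (W.baseChange K) ((2 ^ L : ℕ) : ℤ))).mp
        (hC c c.2).1).1 w)
  have hcl : AddSubgroup.closure (Set.range (fun c : C ↦ (c : galH1Torsion (W.baseChange K) ((2 ^ L : ℕ) : ℤ)))) = C := by
    rw [show Set.range (fun c : C ↦ (c : galH1Torsion (W.baseChange K) ((2 ^ L : ℕ) : ℤ))) = (C : Set _) from
      Subtype.range_coe, AddSubgroup.closure_eq]
  have hcrit : ∀ c ∈ C, (c ∈ (W.baseChange K).torsionLocalKer (w.adicCompletion K) ((2 ^ L : ℕ) : ℤ) ↔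
      h1Eval (W.baseChange K) ((2 ^ L : ℕ) : ℤ) c (ht.conjGalCMH g * g) = 0) := by
    intro c hc
    exact torsionLocalKer_iff_h1Eval_of_isArithFrobAt W hn h𝔔w hF hFT hwbad hnw hunr (by rw [hcl]; exact hc)
  -- ### the free generator of `E(K̄)[2^L]` over `ℤ/2^L[τ̃]` (Q1's mechanism on `Δ < 0`)
  obtain ⟨t₂, ht₂⟩ := exists_twoTorsion_smul_ne_of_Δ_neg W hΔ hc₀
  have ht₂2 : (2 : ℤ) • (t₂ : geomPoints W) = 0 := (mem_geomTorsion_iff W 2 (t₂ : geomPoints W)).mp t₂.2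
  have hct₂ : c₀ • (t₂ : geomPoints W) ≠ (t₂ : geomPoints W) := fun h ↦ ht₂ (Subtype.ext h)
  have hq0 : (((2 ^ (L - 1) : ℕ) : ℤ)) ≠ 0 := by positivity
  obtain ⟨P, hP⟩ := W.zsmul_geomPoints_surjective_of_charZero hq0 (t₂ : geomPoints W)
  have hPv : ((2 ^ (L - 1) : ℕ) : ℤ) • P = (t₂ : geomPoints W) := hP
  have hPM : P ∈ geomTorsion W ((2 ^ L : ℕ) : ℤ) := by
    rw [mem_geomTorsion_iff]
    have h2M : ((2 ^ L : ℕ) : ℤ) = 2 * ((2 ^ (L - 1) : ℕ) : ℤ) := by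
      push_cast
      rw [← pow_succ', Nat.sub_add_cancel hL]
    rw [h2M, mul_smul, hPv, ht₂2]
  set P₀ : geomTorsion W ((2 ^ L : ℕ) : ℤ) := ⟨P, hPM⟩ with hP₀
  have hfree₀ : ∀ a b : ℤ, a • P₀ + b • (c₀ • P₀) = 0 → (2 : ℤ) ^ L ∣ a ∧ (2 : ℤ) ^ L ∣ b := by
    intro a b hab
    have hab' : a • P + b • (c₀ • P) = 0 := congrArg Subtype.val hab
    have hPM' : (2 : ℤ) ^ L • P = 0 := by
      have h := (mem_geomTorsion_iff W _ P).mp hPM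
      push_cast at h
      exact h
    have hPv' : (2 : ℤ) ^ (L - 1) • P = (t₂ : geomPoints W) := by
      have h := hPv
      push_cast at h
      exact h
    exact pow_dvd_of_zsmul_add_zsmul_smul_eq_zero ht₂2 hct₂ L P hPM' hPv' a b hab'
  -- transported to `E(K̄)[2^L]`, where `c₀` acts as `τ̃`
  set θ := RatClosure.torsionEquiv (K := K) W ((2 ^ L : ℕ) : ℤ) with hθ
  have hθc : ht.torsionMap W ((2 ^ L : ℕ) : ℤ) (θ P₀) = θ (c₀ • P₀) := by
    rw [← RatClosure.torsionEquiv_smul_of_lift W ht c₀ (fun _ ↦ rfl) _ P₀]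
  have hA : ∀ t : geomTorsion (W.baseChange K) ((2 ^ L : ℕ) : ℤ), ((2 ^ L : ℕ) : ℤ) • t = 0 := fun t ↦ by
    apply Subtype.ext
    rw [AddSubgroupClass.coe_zsmul, ZeroMemClass.coe_zero]
    exact (mem_geomTorsion_iff (W.baseChange K) _ (t : geomPoints (W.baseChange K))).mp t.2
  have htor : (2 ^ L : ℤ) • θ P₀ = 0 := by exact_mod_cast hA (θ P₀)
  have hfree : ∀ a b : ℤ, a • θ P₀ + b • ht.torsionMap W ((2 ^ L : ℕ) : ℤ) (θ P₀) = 0 →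
      (2 ^ L : ℤ) ∣ a ∧ (2 ^ L : ℤ) ∣ b := by
    intro a b hab
    rw [hθc, ← map_zsmul, ← map_zsmul, ← map_add, map_eq_zero_iff _ θ.injective] at hab
    exact hfree₀ a b hab
  have hcard : Nat.card (geomTorsion (W.baseChange K) ((2 ^ L : ℕ) : ℤ)) = (2 ^ L) ^ 2 :=
    card_torsionPoints_eq_sq_holds (W.baseChange K) (AlgebraicClosure K) (by exact_mod_cast hn)
  have hspan : ∀ Q : geomTorsion (W.baseChange K) ((2 ^ L : ℕ) : ℤ), ∃ a b : ℤ,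
      Q = a • θ P₀ + b • ht.torsionMap W ((2 ^ L : ℕ) : ℤ) (θ P₀) :=
    exists_eq_zsmul_add_zsmul_of_indep hL hA hcard hfree
  -- ### LEAD's algebra: `ker [·, F]` has index `∣ 2` on `C[2]`
  have hequiv : ∀ c, h1EvalHom (W.baseChange K) ((2 ^ L : ℕ) : ℤ) hFT (conjAct W τ ((2 ^ L : ℕ) : ℤ) c) =
      ht.torsionMap W ((2 ^ L : ℕ) : ℤ) (h1EvalHom (W.baseChange K) ((2 ^ L : ℕ) : ℤ) hFT c) := fun c ↦ by
    rw [h1EvalHom_apply, h1EvalHom_apply]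
    exact h1Eval_conjAct_conjGalCMH_mul W ht hinv _ hgT c
  have hker := relIndex_ker_inf_torsionBy_two_dvd_two (ht.torsionMap W ((2 ^ L : ℕ) : ℤ))
    (ht.torsionMap_torsionMap W hinv _) hL (θ P₀) hspan hfree htor (conjAct W τ ((2 ^ L : ℕ) : ℤ))
    (h1EvalHom (W.baseChange K) ((2 ^ L : ℕ) : ℤ) hFT) hequiv C hε (fun c hc ↦ (hC c hc).2)
  -- ### on `C`, the strict condition at the places over `ℓ` IS `ker [·, F]`
  have hsub : (⨅ (v : HeightOneSpectrum (𝓞 K)) (_ : (ℓ : 𝓞 K) ∈ v.asIdeal),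
        (W.baseChange K).torsionLocalKer (v.adicCompletion K) ((2 ^ L : ℕ) : ℤ)).addSubgroupOf
        (C ⊓ AddSubgroup.torsionBy (galH1Torsion (W.baseChange K) ((2 ^ L : ℕ) : ℤ)) (2 : ℤ)) =
      (h1EvalHom (W.baseChange K) ((2 ^ L : ℕ) : ℤ) hFT).ker.addSubgroupOf
        (C ⊓ AddSubgroup.torsionBy (galH1Torsion (W.baseChange K) ((2 ^ L : ℕ) : ℤ)) (2 : ℤ)) := by
    ext ⟨x, hx⟩
    have hxC : x ∈ C := (AddSubgroup.mem_inf.mp hx).1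
    simp only [AddSubgroup.mem_addSubgroupOf, AddSubgroup.mem_iInf, AddMonoidHom.mem_ker, h1EvalHom_apply]
    rw [← hcrit x hxC]
    exact ⟨fun h ↦ h w hℓw, fun h v' hv' ↦ by rw [hwuniq v' hv']; exact h⟩
  change ((⨅ (v : HeightOneSpectrum (𝓞 K)) (_ : (ℓ : 𝓞 K) ∈ v.asIdeal),
      (W.baseChange K).torsionLocalKer (v.adicCompletion K) ((2 ^ L : ℕ) : ℤ)).addSubgroupOf
      (C ⊓ AddSubgroup.torsionBy (galH1Torsion (W.baseChange K) ((2 ^ L : ℕ) : ℤ)) (2 : ℤ))).index ∣ 2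
  rw [hsub]
  exact hker

/-- **`hK` for the weak swap loop, VERBATIM SHAPE, at a deep Zhang–Kolyvagin prime.**  With `V = H¹(K, E[2^L])`,
`A ℓ = ⨅_{v ∋ ℓ} torsionLocalKer_v`, `R` any subgroup of `ε`-eigen SELMER classes (`τ_* c = ε • c`), and `ℓ` a Zhang–Kolyvagin
prime at `2` (`ℓ ∤ 2 N d_K`, inert) with `Frob(ℓ) = Frob(∞)` on `K(E[2^L])` — the `good` primes of the drops (gk2-p4
`exists_deep_kolyvaginPrime_fullOrder_pair_of_data`) —: for every finite `s ⊆ R`,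
**`(A ℓ).relIndex (closure s ⊓ V[2]) ∣ 2`**, i.e. the binder `hK` of `exists_avoiding_of_weakSwapOracle` /
`exists_avoiding_of_twoPrimeReciprocity_weak` / `exists_inv_avoiding_of_twoPrimeReciprocity_weak` at `p = 2`.
[cite: McCallumLMS1991, §5 proof of Prop. 5.2] [cite: WZhang2014, Notations (xii)] -/
theorem relIndex_iInf_torsionLocalKer_closure_dvd_two_of_isKolyvaginPrime [W.IsGloballyMinimal] (hΔ : W.Δ < 0)
    (hK : IsImaginaryQuadratic K)
    {τ : K ≃ₐ[ℚ] K} (hτ : τ ≠ 1) {L : ℕ} (hL : 1 ≤ L) {ℓ : ℕ}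
    (hKol : Zhang2014.IsKolyvaginPrime (W.conductorNorm ℤ) W K 2 ℓ) (hfrob : FrobEqFrobInfty W K (2 ^ L) ℓ)
    {ε : ℤ} (hε : ε = 1 ∨ ε = -1) (R : AddSubgroup (galH1Torsion (W.baseChange K) ((2 ^ L : ℕ) : ℤ)))
    (hR : ∀ c ∈ R, c ∈ selmerGroup (W.baseChange K) ((2 ^ L : ℕ) : ℤ) ∧ conjAct W τ ((2 ^ L : ℕ) : ℤ) c = ε • c)
    (s : Finset (galH1Torsion (W.baseChange K) ((2 ^ L : ℕ) : ℤ)))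
    (hs : (↑s : Set (galH1Torsion (W.baseChange K) ((2 ^ L : ℕ) : ℤ))) ⊆ R) :
    (⨅ (v : HeightOneSpectrum (𝓞 K)) (_ : (ℓ : 𝓞 K) ∈ v.asIdeal),
        (W.baseChange K).torsionLocalKer (v.adicCompletion K) ((2 ^ L : ℕ) : ℤ)).relIndex
      (AddSubgroup.closure (↑s : Set (galH1Torsion (W.baseChange K) ((2 ^ L : ℕ) : ℤ))) ⊓
        AddSubgroup.torsionBy (galH1Torsion (W.baseChange K) ((2 ^ L : ℕ) : ℤ)) (2 : ℤ)) ∣ 2 := by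
  haveI : Fact ℓ.Prime := ⟨hKol.1⟩
  have hle : AddSubgroup.closure (↑s : Set (galH1Torsion (W.baseChange K) ((2 ^ L : ℕ) : ℤ))) ≤ R :=
    (AddSubgroup.closure_le R).mpr hs
  exact relIndex_iInf_torsionLocalKer_inf_torsionBy_two_dvd_two W hΔ hK hτ hL hKol.2.2.2.1 hKol.2.2.1
    (hasGoodReductionAtPrime_of_not_dvd_conductorNorm W hKol.2.1) hfrob hε _ fun c hc ↦ hR c (hle hc)

/-! ## §4 Plug forms: the loop's literal `p = 2` binder, and the KS clause's subgroup `⟨u⟩ ⊔ ⟨x⟩` -/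

/-- **The loop binder with `p := 2` LITERALLY** (`torsionBy V ((2 : ℕ) : ℤ)`, `∣ (2 : ℕ)`): the shape of `hK` in
`exists_level_avoiding_of_weakSwapOracle_pow (p := 2)` etc. after instantiation (no cast bookkeeping for the integrator).
[cite: McCallumLMS1991, §5 proof of Prop. 5.2] -/
theorem relIndex_iInf_torsionLocalKer_closure_dvd_two_of_isKolyvaginPrime_natCast [W.IsGloballyMinimal] (hΔ : W.Δ < 0)
    (hK : IsImaginaryQuadratic K) {τ : K ≃ₐ[ℚ] K} (hτ : τ ≠ 1) {L : ℕ} (hL : 1 ≤ L) {ℓ : ℕ}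
    (hKol : Zhang2014.IsKolyvaginPrime (W.conductorNorm ℤ) W K 2 ℓ) (hfrob : FrobEqFrobInfty W K (2 ^ L) ℓ)
    {ε : ℤ} (hε : ε = 1 ∨ ε = -1) (R : AddSubgroup (galH1Torsion (W.baseChange K) ((2 ^ L : ℕ) : ℤ)))
    (hR : ∀ c ∈ R, c ∈ selmerGroup (W.baseChange K) ((2 ^ L : ℕ) : ℤ) ∧ conjAct W τ ((2 ^ L : ℕ) : ℤ) c = ε • c)
    (s : Finset (galH1Torsion (W.baseChange K) ((2 ^ L : ℕ) : ℤ)))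
    (hs : (↑s : Set (galH1Torsion (W.baseChange K) ((2 ^ L : ℕ) : ℤ))) ⊆ R) :
    (⨅ (v : HeightOneSpectrum (𝓞 K)) (_ : (ℓ : 𝓞 K) ∈ v.asIdeal),
        (W.baseChange K).torsionLocalKer (v.adicCompletion K) ((2 ^ L : ℕ) : ℤ)).relIndex
      (AddSubgroup.closure (↑s : Set (galH1Torsion (W.baseChange K) ((2 ^ L : ℕ) : ℤ))) ⊓
        AddSubgroup.torsionBy (galH1Torsion (W.baseChange K) ((2 ^ L : ℕ) : ℤ)) ((2 : ℕ) : ℤ)) ∣ (2 : ℕ) := by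
  rw [Nat.cast_ofNat]
  exact relIndex_iInf_torsionLocalKer_closure_dvd_two_of_isKolyvaginPrime W hΔ hK hτ hL hKol hfrob hε R hR s hs

omit [W.IsElliptic] in
/-- **Selmer `ε`-eigenclasses form a subgroup**: if every generator in `T ⊆ H¹(K, E[n])` is Selmer with `τ_* t = ε • t`, so is
every element of `⟨T⟩` (`selmerGroup` is a subgroup; `τ_*` is additive). [folklore] -/
theorem forall_mem_closure_selmer_and_conjAct_eq (τ : K ≃ₐ[ℚ] K) (n : ℤ) (ε : ℤ)
    {T : Set (galH1Torsion (W.baseChange K) n)}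
    (hT : ∀ t ∈ T, t ∈ selmerGroup (W.baseChange K) n ∧ conjAct W τ n t = ε • t) :
    ∀ c ∈ AddSubgroup.closure T, c ∈ selmerGroup (W.baseChange K) n ∧ conjAct W τ n c = ε • c := by
  intro c hc
  induction hc using AddSubgroup.closure_induction with
  | mem y hy => exact hT y hy
  | zero => exact ⟨zero_mem _, by rw [map_zero, zsmul_zero]⟩
  | add a b _ _ ha hb => exact ⟨add_mem ha.1 hb.1, by rw [map_add, ha.2, hb.2, zsmul_add]⟩
  | neg a _ ha => exact ⟨neg_mem ha.1, by rw [map_neg, ha.2, zsmul_neg]⟩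

/-- **`hK` on the KS clause's subgroup `⟨u⟩ ⊔ ⟨x⟩`** (`u` = the given SELMER `ε`-eigenclasses, `x` = the seed `c_L(1)`, whose
sign `−w(E)` is the even-depth clause's `ε`), at a deep Zhang–Kolyvagin prime `ℓ`:
`(⨅_{v∋ℓ} torsionLocalKer_v).relIndex ((closure (range u) ⊔ zmultiples x) ⊓ H¹[2]) ∣ 2`. [cite: McCallumLMS1991, §5 Prop. 5.2 (proof)] -/
theorem relIndex_iInf_torsionLocalKer_closure_sup_zmultiples_dvd_two [W.IsGloballyMinimal] (hΔ : W.Δ < 0)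
    (hK : IsImaginaryQuadratic K) {τ : K ≃ₐ[ℚ] K} (hτ : τ ≠ 1) {L : ℕ} (hL : 1 ≤ L) {ℓ : ℕ}
    (hKol : Zhang2014.IsKolyvaginPrime (W.conductorNorm ℤ) W K 2 ℓ) (hfrob : FrobEqFrobInfty W K (2 ^ L) ℓ)
    {ε : ℤ} (hε : ε = 1 ∨ ε = -1) {i : ℕ} (u : Fin i → galH1Torsion (W.baseChange K) ((2 ^ L : ℕ) : ℤ))
    (hu : ∀ j, u j ∈ selmerGroup (W.baseChange K) ((2 ^ L : ℕ) : ℤ) ∧ conjAct W τ ((2 ^ L : ℕ) : ℤ) (u j) = ε • u j)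
    (x : galH1Torsion (W.baseChange K) ((2 ^ L : ℕ) : ℤ))
    (hx : x ∈ selmerGroup (W.baseChange K) ((2 ^ L : ℕ) : ℤ) ∧ conjAct W τ ((2 ^ L : ℕ) : ℤ) x = ε • x) :
    (⨅ (v : HeightOneSpectrum (𝓞 K)) (_ : (ℓ : 𝓞 K) ∈ v.asIdeal),
        (W.baseChange K).torsionLocalKer (v.adicCompletion K) ((2 ^ L : ℕ) : ℤ)).relIndex
      ((AddSubgroup.closure (Set.range u) ⊔ AddSubgroup.zmultiples x) ⊓
        AddSubgroup.torsionBy (galH1Torsion (W.baseChange K) ((2 ^ L : ℕ) : ℤ)) (2 : ℤ)) ∣ 2 := by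
  haveI : Fact ℓ.Prime := ⟨hKol.1⟩
  have hgen : ∀ t ∈ Set.range u ∪ {x},
      t ∈ selmerGroup (W.baseChange K) ((2 ^ L : ℕ) : ℤ) ∧ conjAct W τ ((2 ^ L : ℕ) : ℤ) t = ε • t := by
    rintro t (⟨j, rfl⟩ | ht)
    · exact hu j
    · rw [Set.mem_singleton_iff.mp ht]; exact hx
  have hC : AddSubgroup.closure (Set.range u) ⊔ AddSubgroup.zmultiples x = AddSubgroup.closure (Set.range u ∪ {x}) := by
    rw [AddSubgroup.closure_union, AddSubgroup.zmultiples_eq_closure]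
  rw [hC]
  exact relIndex_iInf_torsionLocalKer_inf_torsionBy_two_dvd_two W hΔ hK hτ hL hKol.2.2.2.1 hKol.2.2.1
    (hasGoodReductionAtPrime_of_not_dvd_conductorNorm W hKol.2.1) hfrob hε _
    (forall_mem_closure_selmer_and_conjAct_eq W τ _ ε hgen)

end Summit.BirchSwinnertonDyer.BirchSwinnertonDyer.Theorems.GenusExact.PlusDescent

end
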